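import Summits.ValiantsHypothesis.ValiantsHypothesis.Theorems.KPlusLogSqLawTropicalShiftDiamondDefs
import Summits.ValiantsHypothesis.ValiantsHypothesis.Theorems.KPlusLogSqLawTropicalShiftGrid

/-!
# Route «KPlusLogSqLaw» — DIAMOND, part 1: digits, the gauge, the grid incidences, inversion of the effective shift

HONEST FRAMING.  Proof file (pure theorems), part 1 of the helper chain `--supports` the crux
`Summit.ValiantsHypothesis.ValiantsHypothesis.Theses.KPlusLogSqLaw.TropicalB` (ledger item `stmt-ValiantsHypothesis-19771`, route `KPlusLogSqLaw`;
object-search cell `pub-symmetroid`, seat val-sym-trop-p5 g8, 2026-08-27).  Nothing here asserts `TropicalB`, `WeakLifting`, `KPlusLogSqLaw`,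
`MatrixDescartes` or anything about `VP ≠ VNP`; the family is quadratic in `m` (leading constant `K − 3`), far inside every open question of the
cell (the `K = 4` fork, the window of `TropicalB`).
CONTENTS.  Digit facts (`hi ≤ 2`, `lo ≤ a`, `lo = 0` off the middle level, a class is determined by its digits, digits of `cls`/`lam`);
the zero-sum gauge `Σ_b κ·shift = Σ_b D·[wrap]` (`gauge_zero_sum`; `mod_lt'`, `wrap_cterm_iff` are SHIFT-GRID's), `tropWeight = Σ φ` (`tropWeight_eq_sum_phi`) and, the support being
full, `φ = g_θ(eshift) + bonus(θ, eshift, cnt, pos, lo)` by pure algebra (`phi_eq`); the grid incidence of column `b` in phase `P ≤ 2m` has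
effective shift `P` (`eshift_cterm`), and when it climbs its companion count and position are `climb P` and `pcol P b` (`cnt_cterm`,
`pos_cterm`), so it scores `g_θ(P) + bonus(θ, P, climb P, pcol P b, jcol P s b)` (`phi_cterm`); conversely an incidence of effective shift
`P` sits on the rotation-`(P mod m)` entry of its column with the grid's high digit (`cell_of_eshift_eq`).
-/

set_option linter.dupNamespace false
set_option autoImplicit false

namespace Summit.ValiantsHypothesis.ValiantsHypothesis.Theorems.LacunarySymmetroidMatrixDescartes.TropicalCensus

open Summit.ValiantsHypothesis.ValiantsHypothesis.Theorems.MatrixDescartes.Negative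
open scoped BigOperators
open Finset

namespace ShiftDiamond

open ShiftThree (shiftZ)
open ShiftSquare (rot)

variable (a n : ℕ)

/-! ### digits -/

/-- the high digit is at most `2`. -/
theorem hi_le_two (l : Fin (a + 3)) : hi a l ≤ 2 := by
  unfold hi; split_ifs <;> omega

/-- the low rung is at most `a`. -/
theorem lo_le (l : Fin (a + 3)) : lo a l ≤ a := by
  unfold lo; have := l.isLt; split_ifs <;> omega

/-- only the middle classes (`hi = 1`) carry rungs. -/
theorem lo_eq_zero_of_hi_ne_one (l : Fin (a + 3)) (h : hi a l ≠ 1) : lo a l = 0 := by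
  unfold hi at h; unfold lo; split_ifs at h ⊢ <;> omega

/-- two classes with the same digits are equal. -/
theorem eq_of_digits {l l' : Fin (a + 3)} (h1 : hi a l = hi a l') (h2 : lo a l = lo a l') : l = l' := by
  apply Fin.ext
  have hl := l.isLt; have hl' := l'.isLt
  unfold hi at h1; unfold lo at h2
  split_ifs at h1 h2 <;> omega

/-- the value of the class `cls h j`. -/
theorem cls_val (h j : ℕ) (hj : j ≤ a) : ((cls a h j hj : Fin (a + 3)) : ℕ) = if h = 0 then 0 else if h = 1 then j + 1 else a + 2 :=
  rfl

/-- digits of the class `cls h j`: high digit `h` (for `h ≤ 2`) … -/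
theorem hi_cls (h j : ℕ) (hj : j ≤ a) (hh : h ≤ 2) : hi a (cls a h j hj) = h := by
  unfold hi
  rw [cls_val]
  by_cases h0 : h = 0
  · simp [h0]
  · by_cases h1 : h = 1
    · have hne : ¬ j = a + 1 := by omega
      simp [h1, hne]
    · have h2 : h = 2 := by omega
      simp [h2]

/-- … and low rung `j` if `h = 1`, else `0`. -/
theorem lo_cls (h j : ℕ) (hj : j ≤ a) : lo a (cls a h j hj) = if h = 1 then j else 0 := by
  unfold lo
  rw [cls_val]
  by_cases h0 : h = 0
  · simp [h0]
  · by_cases h1 : h = 1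
    · have hne : ¬ j = a + 1 := by omega
      simp [h1, hne]
    · simp [h0, h1]

/-- digits of the grid class in column `b`. -/
theorem hi_lam (P s : ℕ) (hP : P ≤ 2 * (n + 1)) (b : Fin (n + 1)) : hi a (lam a n P s b) = hcol n P b := by
  unfold lam
  apply hi_cls
  unfold hcol
  have hb := b.isLt
  have h1 : P / (n + 1) ≤ 2 := by
    calc P / (n + 1) ≤ 2 * (n + 1) / (n + 1) := Nat.div_le_div_right hP
      _ = 2 := Nat.mul_div_cancel 2 (by omega)
  by_cases hw : n + 1 ≤ (b : ℕ) + P % (n + 1)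
  · rw [if_pos hw]
    -- a wrapping column exists only if `P mod m ≥ 1`, so the era is `< 2`
    have hr : 1 ≤ P % (n + 1) := by omega
    have h2 : P / (n + 1) < 2 := by
      by_contra hcon
      have h3 : P / (n + 1) = 2 := by omega
      have h4 := Nat.div_add_mod P (n + 1)
      rw [h3] at h4
      omega
    omega
  · rw [if_neg hw]; omega

/-- the low rung of the grid class is `jcol`. -/
theorem lo_lam (P s : ℕ) (b : Fin (n + 1)) : lo a (lam a n P s b) = jcol a n P s b := by
  unfold lam
  rw [lo_cls]
  unfold jcol
  by_cases h : hcol n P b = 1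
  · rw [if_pos h, if_pos h]
  · rw [if_neg h, if_neg h]

/-! ### constants -/

/-- `W = a·m + 1`. -/
theorem width_cast : (width a n : ℤ) = (a : ℤ) * (n : ℤ) + (a : ℤ) + 1 := by unfold width; push_cast; ring
/-- `κ = 2aW + 2a + 1`. -/
theorem kap_cast : (kap a n : ℤ) = 2 * (a : ℤ) * (width a n : ℤ) + 2 * a + 1 := by unfold kap; push_cast; ring
/-- `D = m·κ`. -/
theorem bigD_cast : (bigD a n : ℤ) = (kap a n : ℤ) * ((n : ℤ) + 1) := by unfold bigD; push_cast; ring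
/-- the exponent in digit form. -/
theorem dd_cast (l : Fin (a + 3)) : (dd a n l : ℤ) = (lo a l : ℤ) + (hi a l : ℤ) * (bigD a n : ℤ) := by
  unfold dd; push_cast; ring

/-! ### the gauge -/

/-- **the gauge is zero-sum**: `Σ_b κ·shift(σ b, b) = Σ_b D·[σ b < b]` for every permutation. -/
theorem gauge_zero_sum (σ : Equiv.Perm (Fin (n + 1))) :
    ∑ b, (kap a n : ℤ) * shiftZ n (σ b) b = ∑ b, (bigD a n : ℤ) * (if ((σ b : Fin (n + 1)) : ℕ) < (b : ℕ) then 1 else 0) := by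
  have hD := bigD_cast a n
  rw [← sub_eq_zero, ← Finset.sum_sub_distrib]
  have h1 : ∀ b, ((kap a n : ℤ) * shiftZ n (σ b) b -
      (bigD a n : ℤ) * (if ((σ b : Fin (n + 1)) : ℕ) < (b : ℕ) then 1 else 0))
      = (kap a n : ℤ) * (((σ b : Fin (n + 1)) : ℕ) : ℤ) - (kap a n : ℤ) * ((b : ℕ) : ℤ) := by
    intro b
    unfold ShiftThree.shiftZ
    rw [hD]
    split_ifs with h <;> ring
  rw [Finset.sum_congr rfl (fun b _ => h1 b), Finset.sum_sub_distrib]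
  have h2 : ∑ b, (kap a n : ℤ) * (((σ b : Fin (n + 1)) : ℕ) : ℤ) = ∑ b : Fin (n + 1), (kap a n : ℤ) * ((b : ℕ) : ℤ) :=
    Equiv.sum_comp σ (fun b : Fin (n + 1) => (kap a n : ℤ) * ((b : ℕ) : ℤ))
  rw [h2, sub_self]

/-- the tropical weight is the sum of the corrected per-incidence scores. -/
theorem tropWeight_eq_sum_phi (θ : ℤ) (q : Equiv.Perm (Fin (n + 1)) × (Fin (n + 1) → Fin (a + 3))) :
    tropWeight (dd a n) (vv a n) θ q = ∑ b, phi a n θ (q.1 b) b (q.2 b) := by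
  unfold tropWeight phi
  have h0 : ∑ b, ((kap a n : ℤ) * shiftZ n (q.1 b) b -
      (bigD a n : ℤ) * (if ((q.1 b : Fin (n + 1)) : ℕ) < (b : ℕ) then 1 else 0)) = 0 := by
    rw [Finset.sum_sub_distrib, gauge_zero_sum, sub_self]
  rw [Finset.sum_sub_distrib, Finset.sum_add_distrib, Finset.sum_sub_distrib, ← Finset.mul_sum]
  have h3 : ∑ b, θ * (kap a n : ℤ) * shiftZ n (q.1 b) b -
      ∑ b, θ * (bigD a n : ℤ) * (if ((q.1 b : Fin (n + 1)) : ℕ) < (b : ℕ) then 1 else 0) = 0 := by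
    rw [← Finset.sum_sub_distrib]
    have : ∀ b, θ * (kap a n : ℤ) * shiftZ n (q.1 b) b -
        θ * (bigD a n : ℤ) * (if ((q.1 b : Fin (n + 1)) : ℕ) < (b : ℕ) then 1 else 0)
        = θ * ((kap a n : ℤ) * shiftZ n (q.1 b) b -
          (bigD a n : ℤ) * (if ((q.1 b : Fin (n + 1)) : ℕ) < (b : ℕ) then 1 else 0)) := fun b => by ring
    rw [Finset.sum_congr rfl (fun b _ => this b), ← Finset.mul_sum, h0, mul_zero]
  linarith

/-- score of ANY incidence: `g_θ(effective shift) + bonus` (the gauge identity is pure algebra). -/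
theorem phi_eq (θ : ℤ) (r b : Fin (n + 1)) (l : Fin (a + 3)) :
    phi a n θ r b l = gval a n θ (eshift a n r b l) + bonus a n θ (eshift a n r b l) (cnt n r b) (pos n r b) (lo a l) := by
  have hD := bigD_cast a n
  unfold phi gval vv bonus eshift
  rw [dd_cast, hD]
  ring

/-! ### the grid incidences -/

/-- the effective shift of the grid incidence in column `b` is the phase `P ≤ 2m`. -/
theorem eshift_cterm (P s : ℕ) (hP : P ≤ 2 * (n + 1)) (b : Fin (n + 1)) :
    eshift a n (rot n (P % (n + 1)) b) b (lam a n P s b) = P := by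
  unfold eshift
  rw [hi_lam a n P s hP, ShiftSquare.shiftZ_rot_of_lt n _ (ShiftGrid.mod_lt' n P) b]
  unfold hcol
  have h := Nat.div_add_mod P (n + 1)
  have h' : ((n : ℤ) + 1) * (P / (n + 1) : ℕ) + (P % (n + 1) : ℕ) = P := by exact_mod_cast h
  by_cases hw : n + 1 ≤ (b : ℕ) + P % (n + 1)
  · rw [if_pos hw, if_pos ((ShiftGrid.wrap_cterm_iff n P b).mpr hw)]; push_cast; linarith
  · rw [if_neg hw, if_neg (fun h'' => hw ((ShiftGrid.wrap_cterm_iff n P b).mp h''))]; push_cast; linarith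

/-- in a CLIMBING column (`hcol = 1`) the grid's entry has `climb P` climbing companions … -/
theorem cnt_cterm (P : ℕ) (b : Fin (n + 1)) (hc : hcol n P b = 1) :
    cnt n (rot n (P % (n + 1)) b) b = climb n P := by
  unfold cnt climb
  rw [ShiftSquare.shiftZ_rot_of_lt n _ (ShiftGrid.mod_lt' n P) b]
  unfold hcol at hc
  have h := Nat.div_add_mod P (n + 1)
  have hr := ShiftGrid.mod_lt' n P
  by_cases hw : n + 1 ≤ (b : ℕ) + P % (n + 1)
  · rw [if_pos hw] at hc
    have he : P / (n + 1) = 0 := by omega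
    rw [he] at h
    have hPn : P ≤ n := by omega
    rw [if_pos ((ShiftGrid.wrap_cterm_iff n P b).mpr hw), if_pos hPn, Nat.mod_eq_of_lt (by omega)]
  · rw [if_neg hw] at hc
    have he : P / (n + 1) = 1 := by omega
    rw [he] at h
    have hPn : ¬ P ≤ n := by omega
    rw [if_neg (fun h'' => hw ((ShiftGrid.wrap_cterm_iff n P b).mp h'')), if_neg hPn]
    omega

/-- … and position `pcol P b` among them. -/
theorem pos_cterm (P : ℕ) (b : Fin (n + 1)) (hc : hcol n P b = 1) :
    pos n (rot n (P % (n + 1)) b) b = pcol n P b := by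
  unfold pos pcol
  unfold hcol at hc
  have h := Nat.div_add_mod P (n + 1)
  have hr := ShiftGrid.mod_lt' n P
  have hv := ShiftSquare.rot_val n (P % (n + 1)) hr.le b
  by_cases hw : n + 1 ≤ (b : ℕ) + P % (n + 1)
  · rw [if_pos hw] at hc hv
    have he : P / (n + 1) = 0 := by omega
    rw [he] at h
    have hPn : P ≤ n := by omega
    rw [if_pos ((ShiftGrid.wrap_cterm_iff n P b).mpr hw), if_pos hPn, hv]
    have hmod : P % (n + 1) = P := Nat.mod_eq_of_lt (by omega)
    simp only [hmod]
  · rw [if_neg hw] at hc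
    have he : P / (n + 1) = 1 := by omega
    rw [he] at h
    have hPn : ¬ P ≤ n := by omega
    rw [if_neg (fun h'' => hw ((ShiftGrid.wrap_cterm_iff n P b).mp h'')), if_neg hPn]

/-- `|ee| ≤ 1` (every incidence is present with sign `±1`). -/
theorem ee_natAbs (r b : Fin (n + 1)) (l : Fin (a + 3)) : (ee a n r b l).natAbs = 1 := by
  unfold ee tau
  rw [Int.natAbs_mul, Int.natAbs_pow, Int.natAbs_neg, Int.natAbs_one, one_pow, one_mul]
  split_ifs
  · rw [Int.natAbs_pow, Int.natAbs_neg, Int.natAbs_one, one_pow]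
  · rfl

/-- every incidence is present. -/
theorem ee_ne_zero (r b : Fin (n + 1)) (l : Fin (a + 3)) : ee a n r b l ≠ 0 := by
  rw [← Int.natAbs_ne_zero, ee_natAbs]; exact one_ne_zero

/-- score of the grid incidence in column `b` at slope `θ` (`P ≤ 2m`). -/
theorem phi_cterm (θ : ℤ) (P s : ℕ) (hP : P ≤ 2 * (n + 1)) (b : Fin (n + 1)) :
    phi a n θ (rot n (P % (n + 1)) b) b (lam a n P s b) =
      gval a n θ P + bonus a n θ P (climb n P) (pcol n P b) (jcol a n P s b) := by
  rw [phi_eq, eshift_cterm a n P s hP, lo_lam]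
  by_cases hc : hcol n P b = 1
  · rw [cnt_cterm n P b hc, pos_cterm n P b hc]
  · have hj : jcol a n P s b = 0 := by unfold jcol; rw [if_neg hc]
    rw [hj]
    unfold bonus priceSum
    simp

/-! ### identification of an incidence by its effective shift -/

/-- an incidence of effective shift `P ≤ 2m` sits on the rotation-`(P mod m)` entry of its column with the grid's high digit. -/
theorem cell_of_eshift_eq (P : ℕ) (r' b : Fin (n + 1)) (l : Fin (a + 3)) (hq : eshift a n r' b l = P) :
    r' = rot n (P % (n + 1)) b ∧ hi a l = hcol n P b := by
  unfold eshift at hq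
  obtain ⟨hs0, hs1⟩ := ShiftSquare.shiftZ_bounds n r' b
  have h := Nat.div_add_mod P (n + 1)
  have hr := ShiftGrid.mod_lt' n P
  set e := P / (n + 1) with he
  set r := P % (n + 1) with hr'
  have hp' : (P : ℤ) = ((n : ℤ) + 1) * e + r := by
    have : ((n + 1) * e + r : ℕ) = P := h
    exact_mod_cast this.symm
  set w : ℤ := (if (r' : ℕ) < (b : ℕ) then 1 else 0) with hw
  have hkey : shiftZ n r' b - r = ((n : ℤ) + 1) * ((e : ℤ) - ((hi a l : ℤ) - w)) := by linarith
  have ht : (e : ℤ) - ((hi a l : ℤ) - w) = 0 := by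
    rcases lt_trichotomy ((e : ℤ) - ((hi a l : ℤ) - w)) 0 with hlt | heq | hgt
    · exfalso
      have : ((n : ℤ) + 1) * ((e : ℤ) - ((hi a l : ℤ) - w)) ≤ ((n : ℤ) + 1) * (-1) :=
        mul_le_mul_of_nonneg_left (by linarith) (by positivity)
      have hr0 : (0 : ℤ) ≤ (r : ℤ) := by positivity
      linarith
    · exact heq
    · exfalso
      have : ((n : ℤ) + 1) * 1 ≤ ((n : ℤ) + 1) * ((e : ℤ) - ((hi a l : ℤ) - w)) :=
        mul_le_mul_of_nonneg_left (by linarith) (by positivity)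
      have hrn : (r : ℤ) ≤ n := by exact_mod_cast Nat.lt_succ_iff.mp hr
      linarith
  have hsr : shiftZ n r' b = r := by rw [ht, mul_zero] at hkey; linarith
  have ha' : r' = rot n r b := ShiftSquare.eq_rot_of_shiftZ_eq_of_lt n r hr r' b hsr
  refine ⟨ha', ?_⟩
  unfold hcol
  have hwrap : ((r' : ℕ) < (b : ℕ)) ↔ n + 1 ≤ (b : ℕ) + r := by rw [ha']; exact ShiftGrid.wrap_cterm_iff n P b
  have hhi : (hi a l : ℤ) = e + w := by linarith
  by_cases hab : (r' : ℕ) < (b : ℕ)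
  · rw [if_pos (hwrap.mp hab)]
    rw [hw, if_pos hab] at hhi
    exact_mod_cast hhi
  · rw [if_neg (fun h' => hab (hwrap.mpr h'))]
    rw [hw, if_neg hab] at hhi
    exact_mod_cast hhi

end ShiftDiamond

end Summit.ValiantsHypothesis.ValiantsHypothesis.Theorems.LacunarySymmetroidMatrixDescartes.TropicalCensus
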